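import Mathlib
import Literature.Computability.AlgebraicComplexity.SimultaneousDoubleProduct

/-!
# Stub `stub_hereditaryBias` — hereditary Fourier bias of the private differences
(crux `PrimeDensityDecay`, stmt-MatrixMultiplication-14311, line `collision-profile-removal`)

Let `p` be a prime and `A B : Fin n → Finset (ZMod p)` two families of blocks of common size `s`
satisfying the simultaneity clause (X) of the simultaneous double product property.  Write
`X = ⋃ A i`, `Y = ⋃ B k` and `X₀ = ⋃ (A j - B j)` (the private differences).  We prove that
every `Z ⊆ X₀` has a nontrivial additive character `ψ` of `ZMod p` with
`‖∑_{z ∈ Z} ψ z‖ ≥ (n s / p) |Z| - s`.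

Proof.  *Faithfulness* (from (X)): if `y ∈ B k`, `z ∈ Z` and `y + z ∈ X`, then `y + z ∈ A k`;
hence the number `N` of solutions of `y + z = x` with `y ∈ Y`, `z ∈ Z`, `x ∈ X` is at most
`|Y| s`.  *Orthogonality*: `p N = ∑_ψ (∑_{y∈Y} ψ y)(∑_{z∈Z} ψ z)(∑_{x∈X} ψ(-x))`, whose `ψ = 1`
term is `|Y| |Z| |X|`; the other terms are bounded using `M = max_{ψ ≠ 1} ‖∑_{z∈Z} ψ z‖`,
`ab ≤ (a² + b²)/2` and *Parseval* `∑_ψ ‖∑_{x∈S} ψ x‖² = p |S|`.  With `|X| = |Y| = n s` (the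
blocks are pairwise disjoint by (X),
`Literature.Computability.AlgebraicComplexity.pairwiseDisjoint_of_simultaneous`) this gives
`(n s)² |Z| ≤ p n s² + M p n s`, i.e. `(n s / p) |Z| - s ≤ M`.

Only Mathlib (`AddChar.sum_apply_eq_ite`, `AddChar.card_eq`, `AddChar.map_neg_eq_conj`, …) and
the Literature disjointness lemma are used; clause (W) is not needed.
-/

-- `Summit.<Summit>.<Problem>` coincide for this single-problem summit: the duplicate is deliberate.
set_option linter.dupNamespace false

namespace Summit.MatrixMultiplication.MatrixMultiplication.Theorems.PrimeDensityDecay.HereditaryBias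

open scoped BigOperators Pointwise ComplexConjugate

section General

variable {G : Type*} [AddCommGroup G] [Fintype G]

/-- For a complex character `ψ` of a finite abelian group and a finite set `S`,
`∑_{x ∈ S} ψ (-x)` is the complex conjugate of `∑_{x ∈ S} ψ x` (the values of `ψ` are
unimodular). -/
theorem sum_map_neg_eq_conj (ψ : AddChar G ℂ) (S : Finset G) :
    ∑ x ∈ S, ψ (-x) = conj (∑ x ∈ S, ψ x) := by
  rw [map_sum]
  exact Finset.sum_congr rfl fun x _ => AddChar.map_neg_eq_conj ψ x

variable [DecidableEq G]

/-- **Parseval, complex form**: `∑_ψ (∑_{x∈S} ψ x)(∑_{y∈S} ψ(-y)) = |G| · |S|`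
(expand the product, swap the sums, orthogonality `AddChar.sum_apply_eq_ite`). -/
theorem sum_charSum_mul_charSum_neg (S : Finset G) :
    ∑ ψ : AddChar G ℂ, (∑ x ∈ S, ψ x) * (∑ y ∈ S, ψ (-y)) =
      (Fintype.card G : ℂ) * S.card := by
  calc ∑ ψ : AddChar G ℂ, (∑ x ∈ S, ψ x) * (∑ y ∈ S, ψ (-y))
      = ∑ ψ : AddChar G ℂ, ∑ x ∈ S, ∑ y ∈ S, ψ (x - y) := by
        refine Finset.sum_congr rfl fun ψ _ => ?_
        rw [Finset.sum_mul_sum]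
        refine Finset.sum_congr rfl fun x _ => Finset.sum_congr rfl fun y _ => ?_
        rw [sub_eq_add_neg, AddChar.map_add_eq_mul]
    _ = ∑ x ∈ S, ∑ y ∈ S, ∑ ψ : AddChar G ℂ, ψ (x - y) := by
        rw [Finset.sum_comm]
        exact Finset.sum_congr rfl fun x _ => Finset.sum_comm
    _ = ∑ x ∈ S, ∑ y ∈ S, if x = y then (Fintype.card G : ℂ) else 0 := by
        refine Finset.sum_congr rfl fun x _ => Finset.sum_congr rfl fun y _ => ?_
        rw [AddChar.sum_apply_eq_ite]
        exact if_congr sub_eq_zero rfl rfl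
    _ = ∑ x ∈ S, (Fintype.card G : ℂ) := by
        refine Finset.sum_congr rfl fun x hx => ?_
        rw [Finset.sum_ite_eq, if_pos hx]
    _ = (Fintype.card G : ℂ) * S.card := by
        rw [Finset.sum_const, nsmul_eq_mul, mul_comm]

/-- **Parseval** for the character sums of a finite set `S` of a finite abelian group `G`:
`∑_ψ ‖∑_{x∈S} ψ x‖² = |G| · |S|`. -/
theorem sum_norm_charSum_sq (S : Finset G) :
    ∑ ψ : AddChar G ℂ, ‖∑ x ∈ S, ψ x‖ ^ 2 = (Fintype.card G : ℝ) * S.card := by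
  have h := sum_charSum_mul_charSum_neg S
  have hψ : ∀ ψ : AddChar G ℂ,
      (∑ x ∈ S, ψ x) * (∑ y ∈ S, ψ (-y)) = ((‖∑ x ∈ S, ψ x‖ ^ 2 : ℝ) : ℂ) := by
    intro ψ
    rw [sum_map_neg_eq_conj, Complex.mul_conj', Complex.ofReal_pow]
  simp_rw [hψ] at h
  exact_mod_cast h

/-- **Counting by orthogonality**: for finite sets `X Y Z` of a finite abelian group `G`,
`∑_ψ (∑_{y∈Y} ψ y)(∑_{z∈Z} ψ z)(∑_{x∈X} ψ(-x)) = |G| · #{(y, z, x) ∈ Y × Z × X : y + z = x}`. -/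
theorem sum_charSum_triple (X Y Z : Finset G) :
    ∑ ψ : AddChar G ℂ, (∑ y ∈ Y, ψ y) * (∑ z ∈ Z, ψ z) * (∑ x ∈ X, ψ (-x)) =
      (Fintype.card G : ℂ) *
        ((∑ y ∈ Y, ∑ z ∈ Z, ∑ x ∈ X, if y + z = x then 1 else 0 : ℕ) : ℂ) := by
  calc ∑ ψ : AddChar G ℂ, (∑ y ∈ Y, ψ y) * (∑ z ∈ Z, ψ z) * (∑ x ∈ X, ψ (-x))
      = ∑ ψ : AddChar G ℂ, ∑ y ∈ Y, ∑ z ∈ Z, ∑ x ∈ X, ψ (y + z + -x) := by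
        refine Finset.sum_congr rfl fun ψ _ => ?_
        rw [Finset.sum_mul_sum, Finset.sum_mul]
        refine Finset.sum_congr rfl fun y _ => ?_
        rw [Finset.sum_mul]
        refine Finset.sum_congr rfl fun z _ => ?_
        rw [Finset.mul_sum]
        refine Finset.sum_congr rfl fun x _ => ?_
        rw [← AddChar.map_add_eq_mul, ← AddChar.map_add_eq_mul]
    _ = ∑ y ∈ Y, ∑ z ∈ Z, ∑ x ∈ X, ∑ ψ : AddChar G ℂ, ψ (y + z + -x) := by
        rw [Finset.sum_comm]
        refine Finset.sum_congr rfl fun y _ => ?_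
        rw [Finset.sum_comm]
        refine Finset.sum_congr rfl fun z _ => ?_
        exact Finset.sum_comm
    _ = ∑ y ∈ Y, ∑ z ∈ Z, ∑ x ∈ X, if y + z = x then (Fintype.card G : ℂ) else 0 := by
        refine Finset.sum_congr rfl fun y _ => Finset.sum_congr rfl fun z _ =>
          Finset.sum_congr rfl fun x _ => ?_
        rw [AddChar.sum_apply_eq_ite]
        exact if_congr (by rw [← sub_eq_add_neg, sub_eq_zero]) rfl rfl
    _ = (Fintype.card G : ℂ) *
          ((∑ y ∈ Y, ∑ z ∈ Z, ∑ x ∈ X, if y + z = x then 1 else 0 : ℕ) : ℂ) := by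
        simp only [Nat.cast_sum, Nat.cast_ite, Nat.cast_one, Nat.cast_zero, Finset.mul_sum,
          mul_ite, mul_one, mul_zero]

/-- **Key inequality.**  If `‖∑_{z∈Z} ψ z‖ ≤ M` for every nontrivial character `ψ` (`0 ≤ M`)
and the number of solutions of `y + z = x` (`y ∈ Y`, `z ∈ Z`, `x ∈ X`) is at most `N`, then
`|Y| |Z| |X| ≤ |G| N + M (|G| |Y| + |G| |X|) / 2`: isolate the `ψ = 1` term of
`sum_charSum_triple`, bound the others by `‖a‖ M ‖b‖ ≤ M (‖a‖² + ‖b‖²) / 2` and use Parseval. -/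
theorem card_mul_card_mul_card_le (X Y Z : Finset G) {M : ℝ} (hM0 : 0 ≤ M)
    (hM : ∀ ψ : AddChar G ℂ, ψ ≠ 1 → ‖∑ z ∈ Z, ψ z‖ ≤ M) {N : ℕ}
    (hN : (∑ y ∈ Y, ∑ z ∈ Z, ∑ x ∈ X, if y + z = x then 1 else 0 : ℕ) ≤ N) :
    (Y.card : ℝ) * Z.card * X.card ≤
      Fintype.card G * N +
        M * ((Fintype.card G * Y.card + Fintype.card G * X.card) / 2) := by
  classical
  set F : AddChar G ℂ → ℂ :=
    fun ψ => (∑ y ∈ Y, ψ y) * (∑ z ∈ Z, ψ z) * (∑ x ∈ X, ψ (-x)) with hF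
  have hsum : ∑ ψ, F ψ = (Fintype.card G : ℂ) *
      ((∑ y ∈ Y, ∑ z ∈ Z, ∑ x ∈ X, if y + z = x then 1 else 0 : ℕ) : ℂ) :=
    sum_charSum_triple X Y Z
  have hF1 : F 1 = (Y.card : ℂ) * Z.card * X.card := by
    simp only [hF, AddChar.one_apply, Finset.sum_const, nsmul_eq_mul, mul_one]
  have hsplit : F 1 = ∑ ψ, F ψ - ∑ ψ ∈ Finset.univ.erase (1 : AddChar G ℂ), F ψ := by
    rw [← Finset.add_sum_erase Finset.univ F (Finset.mem_univ 1), add_sub_cancel_right]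
  have hterm : ∀ ψ ∈ Finset.univ.erase (1 : AddChar G ℂ),
      ‖F ψ‖ ≤ M * ((‖∑ y ∈ Y, ψ y‖ ^ 2 + ‖∑ x ∈ X, ψ x‖ ^ 2) / 2) := by
    intro ψ hψ
    have hψ1 : ψ ≠ 1 := Finset.ne_of_mem_erase hψ
    have hnx : ‖∑ x ∈ X, ψ (-x)‖ = ‖∑ x ∈ X, ψ x‖ := by
      rw [sum_map_neg_eq_conj, Complex.norm_conj]
    have h2 := two_mul_le_add_sq ‖∑ y ∈ Y, ψ y‖ ‖∑ x ∈ X, ψ x‖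
    calc ‖F ψ‖ = ‖∑ y ∈ Y, ψ y‖ * ‖∑ z ∈ Z, ψ z‖ * ‖∑ x ∈ X, ψ x‖ := by
          rw [hF, norm_mul, norm_mul, hnx]
      _ ≤ ‖∑ y ∈ Y, ψ y‖ * M * ‖∑ x ∈ X, ψ x‖ := by gcongr; exact hM ψ hψ1
      _ = M * (2 * ‖∑ y ∈ Y, ψ y‖ * ‖∑ x ∈ X, ψ x‖) / 2 := by ring
      _ ≤ M * (‖∑ y ∈ Y, ψ y‖ ^ 2 + ‖∑ x ∈ X, ψ x‖ ^ 2) / 2 := by gcongr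
      _ = M * ((‖∑ y ∈ Y, ψ y‖ ^ 2 + ‖∑ x ∈ X, ψ x‖ ^ 2) / 2) := by ring
  calc (Y.card : ℝ) * Z.card * X.card = ‖F 1‖ := by
        rw [hF1, norm_mul, norm_mul, Complex.norm_natCast, Complex.norm_natCast,
          Complex.norm_natCast]
    _ = ‖∑ ψ, F ψ - ∑ ψ ∈ Finset.univ.erase (1 : AddChar G ℂ), F ψ‖ := by rw [← hsplit]
    _ ≤ ‖∑ ψ, F ψ‖ + ‖∑ ψ ∈ Finset.univ.erase (1 : AddChar G ℂ), F ψ‖ := norm_sub_le _ _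
    _ ≤ (Fintype.card G : ℝ) * N + ∑ ψ ∈ Finset.univ.erase (1 : AddChar G ℂ), ‖F ψ‖ := by
        gcongr ?_ + ?_
        · rw [hsum, norm_mul, Complex.norm_natCast, Complex.norm_natCast]
          gcongr
        · exact norm_sum_le _ _
    _ ≤ (Fintype.card G : ℝ) * N + ∑ ψ ∈ Finset.univ.erase (1 : AddChar G ℂ),
          M * ((‖∑ y ∈ Y, ψ y‖ ^ 2 + ‖∑ x ∈ X, ψ x‖ ^ 2) / 2) := by
        gcongr with ψ hψ
        exact hterm ψ hψ
    _ ≤ (Fintype.card G : ℝ) * N + ∑ ψ : AddChar G ℂ,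
          M * ((‖∑ y ∈ Y, ψ y‖ ^ 2 + ‖∑ x ∈ X, ψ x‖ ^ 2) / 2) := by
        gcongr ?_ + ?_
        · exact le_rfl
        · exact Finset.sum_le_univ_sum_of_nonneg fun ψ => mul_nonneg hM0 (by positivity)
    _ = (Fintype.card G : ℝ) * N +
          M * ((Fintype.card G * Y.card + Fintype.card G * X.card) / 2) := by
        rw [← Finset.mul_sum, ← Finset.sum_div, Finset.sum_add_distrib, sum_norm_charSum_sq,
          sum_norm_charSum_sq]

end General

section Families

variable {G : Type*} [AddCommGroup G] [DecidableEq G] {n s : ℕ}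

/-- **Faithfulness count.**  Under the simultaneity clause (X), if `y ∈ B k`,
`z ∈ Z ⊆ ⋃ (A j - B j)` and `y + z ∈ ⋃ A i`, then `y + z ∈ A k`; hence the number of solutions
of `y + z = x` with `y ∈ ⋃ B k`, `z ∈ Z`, `x ∈ ⋃ A i` is at most `|⋃ B k| · s` when every `A i`
has `s` elements. -/
theorem tripleCount_le (A B : Fin n → Finset G)
    (hcard : ∀ i : Fin n, (A i).card = s ∧ (B i).card = s)
    (hX : ∀ i j k : Fin n, ∀ a ∈ A i, ∀ a' ∈ A j, ∀ b ∈ B j, ∀ b' ∈ B k,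
      (a - a') + (b - b') = 0 → i = k)
    (Z : Finset G) (hZ : Z ⊆ Finset.univ.biUnion fun i => A i - B i) :
    (∑ y ∈ Finset.univ.biUnion B, ∑ z ∈ Z, ∑ x ∈ Finset.univ.biUnion A,
        if y + z = x then 1 else 0 : ℕ) ≤ (Finset.univ.biUnion B).card * s := by
  calc (∑ y ∈ Finset.univ.biUnion B, ∑ z ∈ Z, ∑ x ∈ Finset.univ.biUnion A,
        if y + z = x then 1 else 0 : ℕ)
      ≤ ∑ _y ∈ Finset.univ.biUnion B, s := by
        refine Finset.sum_le_sum fun y hy => ?_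
        obtain ⟨k, -, hyk⟩ := Finset.mem_biUnion.mp hy
        simp_rw [Finset.sum_ite_eq]
        rw [← Finset.card_filter, ← (hcard k).1]
        refine Finset.card_le_card_of_injOn (fun z => y + z) ?_ ?_
        · intro z hz
          obtain ⟨hzZ, hzX⟩ := Finset.mem_filter.mp (Finset.mem_coe.mp hz)
          obtain ⟨i, -, hi⟩ := Finset.mem_biUnion.mp hzX
          obtain ⟨j, -, hj⟩ := Finset.mem_biUnion.mp (hZ hzZ)
          obtain ⟨a', ha', b', hb', rfl⟩ := Finset.mem_sub.mp hj
          have hik : i = k := hX i j k _ hi a' ha' b' hb' y hyk (by abel)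
          subst hik
          exact Finset.mem_coe.mpr hi
        · intro z₁ _ z₂ _ h
          exact add_left_cancel h
    _ = (Finset.univ.biUnion B).card * s := by
        rw [Finset.sum_const, smul_eq_mul]

/-- Under (X) with all blocks of size `s ≥ 1` the `A i` are pairwise disjoint and so are the
`B i` (`Literature.Computability.AlgebraicComplexity.pairwiseDisjoint_of_simultaneous`), hence
`|⋃ A i| = n s` and `|⋃ B i| = n s`. -/
theorem card_biUnion_eq (A B : Fin n → Finset G)
    (hcard : ∀ i : Fin n, (A i).card = s ∧ (B i).card = s)
    (hX : ∀ i j k : Fin n, ∀ a ∈ A i, ∀ a' ∈ A j, ∀ b ∈ B j, ∀ b' ∈ B k,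
      (a - a') + (b - b') = 0 → i = k)
    (hs : 0 < s) :
    (Finset.univ.biUnion A).card = n * s ∧ (Finset.univ.biUnion B).card = n * s := by
  have hne : ∀ i : Fin n, (A i).Nonempty ∧ (B i).Nonempty := fun i =>
    ⟨Finset.card_pos.mp (by rw [(hcard i).1]; exact hs),
      Finset.card_pos.mp (by rw [(hcard i).2]; exact hs)⟩
  have hd := Literature.Computability.AlgebraicComplexity.pairwiseDisjoint_of_simultaneous hX hne
  have hA : ((Finset.univ : Finset (Fin n)) : Set (Fin n)).PairwiseDisjoint A :=
    fun i _ j _ hij => (hd i j hij).1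
  have hB : ((Finset.univ : Finset (Fin n)) : Set (Fin n)).PairwiseDisjoint B :=
    fun i _ j _ hij => (hd i j hij).2
  refine ⟨?_, ?_⟩
  · rw [Finset.card_biUnion hA, Finset.sum_congr rfl fun i _ => (hcard i).1, Finset.sum_const,
      Finset.card_univ, Fintype.card_fin, smul_eq_mul]
  · rw [Finset.card_biUnion hB, Finset.sum_congr rfl fun i _ => (hcard i).2, Finset.sum_const,
      Finset.card_univ, Fintype.card_fin, smul_eq_mul]

end Families

/-- **Hereditary bias**: under (X) and balance, every subset `Z` of the private differences `X₀ = ⋃ (A i − B i)` has a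
nontrivial additive character `ψ` of `ZMod p` with `‖Σ_{z∈Z} ψ z‖ ≥ (n s / p)·|Z| − s`. -/
theorem stub_hereditaryBias :
    ∀ p : ℕ, p.Prime → ∀ (n s : ℕ) (A B : Fin n → Finset (ZMod p)),
    (∀ i : Fin n, (A i).card = s ∧ (B i).card = s) →
    (∀ i j k : Fin n, ∀ a ∈ A i, ∀ a' ∈ A j, ∀ b ∈ B j, ∀ b' ∈ B k, (a - a') + (b - b') = 0 → i = k) →
    ∀ Z : Finset (ZMod p), Z ⊆ (Finset.univ.biUnion fun i => A i - B i) →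
      ∃ ψ : AddChar (ZMod p) ℂ, ψ ≠ 1 ∧
        (n : ℝ) * (s : ℝ) / (p : ℝ) * (Z.card : ℝ) - (s : ℝ) ≤ ‖∑ z ∈ Z, ψ z‖ := by
  intro p hp n s A B hcard hX Z hZ
  haveI : NeZero p := ⟨hp.ne_zero⟩
  -- a nontrivial character maximising `‖∑_{z ∈ Z} ψ z‖` (there is one since `p ≥ 2`)
  have h1 : 1 < Fintype.card (AddChar (ZMod p) ℂ) := by
    rw [AddChar.card_eq, ZMod.card]
    exact hp.one_lt
  obtain ⟨ψ₁, hψ₁⟩ := Fintype.exists_ne_of_one_lt_card h1 1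
  haveI : Nonempty {ψ : AddChar (ZMod p) ℂ // ψ ≠ 1} := ⟨⟨ψ₁, hψ₁⟩⟩
  obtain ⟨⟨ψ₀, hψ₀⟩, hmax⟩ :=
    Finite.exists_max fun ψ : {ψ : AddChar (ZMod p) ℂ // ψ ≠ 1} => ‖∑ z ∈ Z, ψ.1 z‖
  refine ⟨ψ₀, hψ₀, ?_⟩
  have hM : ∀ ψ : AddChar (ZMod p) ℂ, ψ ≠ 1 → ‖∑ z ∈ Z, ψ z‖ ≤ ‖∑ z ∈ Z, ψ₀ z‖ :=
    fun ψ hψ => hmax ⟨ψ, hψ⟩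
  have hM0 : 0 ≤ ‖∑ z ∈ Z, ψ₀ z‖ := norm_nonneg _
  -- degenerate cases `n = 0` and `s = 0`: the left-hand side is `≤ 0`
  rcases Nat.eq_zero_or_pos n with rfl | hn
  · simp only [Nat.cast_zero, zero_mul, zero_div, zero_sub]
    exact (neg_nonpos.mpr (Nat.cast_nonneg s)).trans hM0
  rcases Nat.eq_zero_or_pos s with rfl | hs
  · simp only [Nat.cast_zero, mul_zero, zero_div, zero_mul, sub_zero]
    exact hM0
  -- main case: `|X| = |Y| = n s`, `N ≤ |Y| s`, and the key inequality
  obtain ⟨hXc, hYc⟩ := card_biUnion_eq A B hcard hX hs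
  have hN := tripleCount_le A B hcard hX Z hZ
  have key :=
    card_mul_card_mul_card_le (Finset.univ.biUnion A) (Finset.univ.biUnion B) Z hM0 hM hN
  have hx : ((Finset.univ.biUnion A).card : ℝ) = n * s := by exact_mod_cast hXc
  have hy : ((Finset.univ.biUnion B).card : ℝ) = n * s := by exact_mod_cast hYc
  have hc : (Fintype.card (ZMod p) : ℝ) = p := by rw [ZMod.card]
  have hNr : (((Finset.univ.biUnion B).card * s : ℕ) : ℝ) = n * s * s := by
    push_cast
    rw [hy]
  rw [hx, hy, hc, hNr] at key
  -- divide `(n s)² |Z| ≤ p n s² + M p n s` by `p n s > 0`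
  have hp0 : (0 : ℝ) < p := by exact_mod_cast hp.pos
  have hn0 : (0 : ℝ) < n := by exact_mod_cast hn
  have hs0 : (0 : ℝ) < s := by exact_mod_cast hs
  have hns : (0 : ℝ) < n * s := mul_pos hn0 hs0
  rw [sub_le_iff_le_add', div_mul_eq_mul_div, div_le_iff₀ hp0]
  refine le_of_mul_le_mul_left ?_ hns
  linarith [key]

end Summit.MatrixMultiplication.MatrixMultiplication.Theorems.PrimeDensityDecay.HereditaryBias
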